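import Mathlib.ModelTheory.LanguageMap
import Mathlib.ModelTheory.Syntax
import Mathlib.ModelTheory.Semantics
import Mathlib.ModelTheory.Satisfiability
import Mathlib.ModelTheory.Complexity
import Mathlib.ModelTheory.Order
import Literature.Analysis.FunctionSpaces.PVFunctions
import Literature.Computability.MetaComplexity.BoundedArithSyntax
import Literature.Computability.MetaComplexity.BoundedArithTheories
import HarnessLib

-- provenance: harness21/H21/H21/Prelude/AnalysisL/PVTheory.lean @ a7c44c5 (interim HEAD d8f2665); M5 mechanical rewrite
/-!
# The language `L(PV)`, the theories `PV₁`, `S₂ⁱ(PV)`, `T₂ⁱ(PV)` and conservativity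
(trunk CplxMeta, G28 item P9)

We extend Buss's language of bounded arithmetic (`Language.boundedArith`, G14) by one function
symbol for every description `f : PVFun n` of a polynomial-time function in Cobham's algebra
(item P8, `Literature.Prelude.AnalysisL.PVFunctions`), obtaining the first-order language
`Language.pv = L(PV)` with its standard model `ℕ` (`funMap f v := f.eval v`).  Buss's language
embeds symbol-to-symbol via the language map `boundedArithToPV : Language.boundedArith →ᴸ
Language.pv` (Buss's `S` goes to the derived symbol `PVFun.succ`), which is an expansion on `ℕ`.

On top of this we set up

* the `Σᵇᵢ(PV) / Πᵇᵢ(PV)` hierarchy `IsSigmabPV`, `IsPibPV` of bounded `L(PV)`-formulas (the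
  clauses of G14's `IsSigmab`/`IsPib` verbatim, bounding terms now `L(PV)`-terms), the classes
  `IsForallSigmabPV i` of `∀Σᵇᵢ(PV)` sentences and `sigmabPVFormulas i`;
* the defining axioms `PVdef` of the `PV` symbols: universal closures of the defining equations
  of `PVFun.eval` (composition `compAxiom`, projections `projAxiom`, limited recursion on
  notation `limRecZeroAxiom`/`limRecBitAxiom` with the truncation `min` spelled out with `≤`,
  and a finite list `initialAxioms` for the initial symbols);
* the induction axioms `pvPindAxiom`, `pvIndAxiom` (G14 `pindAxiom`, `indAxiom` transcribed) and
  the theories `PV1` (`PV₁`), `S2PV i` (`S₂ⁱ(PV)`), `T2PV i` (`T₂ⁱ(PV)`);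
* the classical relations between them (`S2PV_one_extends_PV1`,
  `S2PV_one_isConservativeOver_PV1`, `S2PV_extends_to_T2PV` (for `i ≥ 1`, as G14
  `S2_extends_T2`; successor form `S2PV_succ_extends_to_T2PV_succ`),
  `T2PV_extends_to_S2PV_succ` (all `i`)) and
  the Krajíček–Pudlák–Takeuti hypothesis `KPTHypothesis i` ("`S₂ⁱ⁺¹(PV)` is conservative over
  `T₂ⁱ(PV)`"), whose complexity-theoretic consequence (collapse of `PH`) is stated elsewhere.

## Sources

* S. A. Cook, *Feasibly constructive proofs and the propositional calculus*, STOC 1975, §2–3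
  (`PV`, `PV₁`).
* S. R. Buss, *Bounded Arithmetic*, Bibliopolis 1986, §2.4, §2.6 (Thm. 2.6, Cor. 2.16), Ch. 6
  (`S₂¹(PV)`, `PV₁`, conservativity of `S₂¹(PV)` over `PV₁` for `∀Σᵇ₁(PV)` sentences).
* J. Krajíček, P. Pudlák, G. Takeuti, *Bounded arithmetic and the polynomial hierarchy*,
  Ann. Pure Appl. Logic 52 (1991) 143–153.
* J. Krajíček, *Bounded Arithmetic, Propositional Logic and Complexity Theory*, CUP 1995,
  Def. 5.3.1 (`PV₁`), §5.2 (Lemma 5.2.5, Thm. 5.2.7), §5.3, §7.2 (witnessing and the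
  `∀Σᵇ₁(PV)`-conservativity of `S₂¹(PV)` over `PV₁`), §7 (KPT).

## Mathlib anchors used (verified by grep)

`FirstOrder.Language`, `Language.LHom` (`→ᴸ`) with `onTerm`, `onBoundedFormula`, `onSentence`,
`onTheory`, `LHom.Injective`, `LHom.IsExpansionOn` and the lemmas `LHom.realize_onTerm`,
`LHom.realize_onBoundedFormula`, `LHom.realize_onSentence`, `LHom.onTheory_model`;
`Language.IsOrdered`, `Language.OrderedStructure`, `Term.le`; `BoundedFormula.IsQF`,
`BoundedFormula.IsUniversal` (Mathlib *has* universal formulas: `IsUniversalSentence` below is a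
thin abbreviation of it, kept for the outline's name), `BoundedFormula.alls`, `Theory.Model`,
`Theory.ModelsBoundedFormula` (`⊨ᵇ`); G14's `closeFin`, `allLast`, `instLast`, `substLast`,
`ballLE`, `bexLE`, `Theory.Extends`, `Theory.IsConservativeOver`.  Mathlib has no `PV`, no
bounded arithmetic and no induction schemes (grep `Cobham`, `PIND`, `bounded arithmetic`).

## Design choices

* `FirstOrder.Language.pv` is deliberately placed in Mathlib's `FirstOrder.Language` namespace
  (dot-notation extension, exactly as G14's `FirstOrder.Language.boundedArith`); everything else
  is in `Literature.CplxMeta`.  The `IsOrdered`/`Structure ℕ`/`OrderedStructure ℕ`/`IsExpansionOn ℕ`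
  instances are canonical instances on a *new* language / language map and override nothing.
* Every `PVFun n` (including composites such as `PVFun.succ`) is an `n`-ary symbol of `L(PV)`;
  hence Buss's `S` is mapped to the symbol `PVFun.succ` and `boundedArithToPV` is injective.
* `Σᵇ₀(PV) = Πᵇ₀(PV)` are the sharply bounded `L(PV)`-formulas `IsSharplyBoundedPV`, generated
  from the open formulas by the connectives and `(∀ x ≤ |t|)`, `(∃ x ≤ |t|)` with `t` an
  arbitrary `L(PV)`-term (`ballLELenPV t φ := ballLE (pvLen t) φ`), as in Buss 1986, Ch. 6.
* The truncation `min a c` in the recursion equations of `PVFun.eval` is expressed by the open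
  formula `IsMinFormula f a c := (a ≤ c → f = a) ∧ (¬ a ≤ c → f = c)`; the side condition
  "`s_b y ≠ 0`" of the step equation is the hypothesis `∼(s_b y =' 0)`.
* `PV1 := PVdef ∪ BASIC(PV) ∪ open-PIND` is the H21 rendering ('?') of `PV₁`
  (Krajíček–Pudlák–Takeuti 1991; Krajíček 1995, Def. 5.3.1: "`PV₁` is `PV` plus `PIND` for open
  formulas", conservative over the equational `PV`).  The alternative axiomatisation — the set
  of universal consequences of Cook's equational theory `PV` (Cook 1975, §3) — has the same
  theorems by KPT 1991, §1; we record the choice rather than prove the equivalence.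
* `S2PV i` / `T2PV i` have `PIND` / `IND` for `Σᵇᵢ` formulas *of `L(PV)`* (Buss 1986, §2.4 and
  Ch. 6; Krajíček 1995, §5.3), not merely for translated Buss formulas: otherwise open `PIND` for
  formulas mentioning `PV` symbols would be missing and `S2PV_one_extends_PV1` would fail.
* `ℕ ⊨ T` facts are theorems, never instances (G14 convention).
* The name `openFormulas` (the family of open `L(PV)`-formulas, parallel to
  `sigmabPVFormulas`) is the one fixed by the architect's outline (P9).
* Generic structural lemmas on language maps (`LHom.onTerm_relabel`,
  `LHom.onBoundedFormula_not/inf/ex`, `BoundedFormula.IsQF.onBoundedFormula`) are deliberate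
  dot-notation extensions of Mathlib namespaces (no Mathlib declaration of these names exists).
-/

namespace Literature.Analysis.FunctionSpaces

open FirstOrder FirstOrder.Language

/-! ## The language `L(PV)` and its standard model -/

/-- The first-order language `L(PV)` of Cook's `PV` viewed as a theory with quantifiers: one
`n`-ary function symbol for every `f : PVFun n` (every description of a polynomial-time function
in Cobham's algebra) and the single binary relation symbol `≤` (Cook 1975, §2; Buss 1986, Ch. 6;
Krajíček 1995, Def. 5.3.1).  Deliberately placed in Mathlib's `FirstOrder.Language` namespace,
following `FirstOrder.Language.boundedArith` (G14) and `FirstOrder.Language.presburger`. [cite: Cook1975, §2] -/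
def _root_.FirstOrder.Language.pv : Language :=
  { Functions := PVFun, Relations := Literature.Computability.MetaComplexity.BoundedArithRel }

/-- `L(PV)` is an ordered language: its `≤` symbol is `BoundedArithRel.le` (Buss 1986, Ch. 6;
Mathlib `Language.IsOrdered`). [cite: Buss1986, Ch. 6] -/
instance instIsOrderedPV : Language.pv.IsOrdered := ⟨Literature.Computability.MetaComplexity.BoundedArithRel.le⟩

/-- The standard model `ℕ` of `L(PV)`: the symbol `f : PVFun n` is interpreted by its standard
interpretation `PVFun.eval f`, and `≤` by the order of `ℕ` (Cook 1975, §2; Buss 1986, Ch. 6). [cite: Cook1975, §2] -/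
instance instStructureNatPV : Language.pv.Structure ℕ where
  funMap f v := PVFun.eval f v
  RelMap
    | .le, v => v 0 ≤ v 1

/-- In the standard model `ℕ` of `L(PV)` the symbol `≤` is the order of `ℕ`
(Mathlib `Language.OrderedStructure`; Buss 1986, Ch. 6). [cite: Buss1986, Ch. 6] -/
instance instOrderedStructureNatPV : Language.pv.OrderedStructure ℕ :=
  ⟨fun _ => Iff.rfl⟩

/-- Interpretation of a `PV` symbol in `ℕ` is `PVFun.eval` (Cook 1975, §2). [cite: Cook1975, §2] -/
@[simp] theorem funMap_pv {n : ℕ} (f : PVFun n) (v : Fin n → ℕ) :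
    Structure.funMap (L := Language.pv) f v = f.eval v := rfl

/-- Interpretation of `≤` of `L(PV)` in `ℕ` (Buss 1986, Ch. 6). [cite: Buss1986, Ch. 6] -/
@[simp] theorem relMap_pv_le (v : Fin 2 → ℕ) :
    Structure.RelMap (L := Language.pv) Literature.Computability.MetaComplexity.BoundedArithRel.le v ↔ v 0 ≤ v 1 := Iff.rfl

/-! ## The embedding of Buss's language -/

/-- The symbol table of the embedding `L(S₂) → L(PV)`: `0, ⌊·/2⌋, |·|, +, ·, #` go to the
corresponding initial `PV` symbols and Buss's successor `S` to the derived symbol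
`PVFun.succ = x + s₁(0)` (Buss 1986, Ch. 6: `S₂ⁱ(PV)` contains the language of `S₂`). [cite: Buss1986, Ch. 6:  S₂ⁱ(PV] -/
def _root_.Literature.Computability.MetaComplexity.BoundedArithFunc.toPV : {n : ℕ} → Literature.Computability.MetaComplexity.BoundedArithFunc n → PVFun n
  | _, .zero => .zero
  | _, .succ => PVFun.succ
  | _, .half => .half
  | _, .len => .len
  | _, .add => .add
  | _, .mul => .mul
  | _, .smash => .smash

/-- The language map `L(S₂) →ᴸ L(PV)` embedding Buss's language of bounded arithmetic into the
language of `PV` (functions via `BoundedArithFunc.toPV`, `≤ ↦ ≤`) (Buss 1986, Ch. 6;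
Krajíček 1995, §5.3; Mathlib `FirstOrder.Language.LHom`). [cite: Buss1986, Ch. 6] -/
def boundedArithToPV : Language.boundedArith →ᴸ Language.pv where
  onFunction := fun _ f => Literature.Computability.MetaComplexity.BoundedArithFunc.toPV f
  onRelation := fun _ r => r

/-- The embedding `L(S₂) →ᴸ L(PV)` commutes with the standard interpretations on `ℕ`
(Mathlib `LHom.IsExpansionOn`; the only non-trivial case is `S ↦ x + s₁(0)`, by
`PVFun.eval_succ`) (Buss 1986, Ch. 6). [cite: Buss1986, Ch. 6] -/
instance instIsExpansionOnBoundedArithToPV : boundedArithToPV.IsExpansionOn ℕ where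
  map_onFunction f x := by
    cases f <;> rfl
  map_onRelation R x := by
    cases R; rfl

/-- The embedding preserves the value of terms in `ℕ` (Mathlib `LHom.realize_onTerm`). [folklore] -/
theorem realize_onTerm_boundedArithToPV {α : Type} (t : Language.boundedArith.Term α)
    (v : α → ℕ) : (boundedArithToPV.onTerm t).realize v = t.realize v :=
  LHom.realize_onTerm boundedArithToPV t v

/-- The embedding preserves the truth of bounded formulas in `ℕ`
(Mathlib `LHom.realize_onBoundedFormula`). [folklore] -/
theorem realize_onBoundedFormula_boundedArithToPV {α : Type} {n : ℕ}
    (φ : Language.boundedArith.BoundedFormula α n) (v : α → ℕ) (xs : Fin n → ℕ) :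
    (boundedArithToPV.onBoundedFormula φ).Realize v xs ↔ φ.Realize v xs :=
  LHom.realize_onBoundedFormula boundedArithToPV φ

/-- The embedding preserves the truth of sentences in `ℕ` (Mathlib `LHom.realize_onSentence`). [folklore] -/
theorem realize_onSentence_boundedArithToPV (φ : Language.boundedArith.Sentence) :
    ℕ ⊨ boundedArithToPV.onSentence φ ↔ ℕ ⊨ φ :=
  LHom.realize_onSentence (M := ℕ) boundedArithToPV φ

/-- `ℕ` is a model of the translation of a theory iff it is a model of the theory
(Mathlib `LHom.onTheory_model`). [folklore] -/
theorem model_nat_onTheory_boundedArithToPV_iff (T : Language.boundedArith.Theory) :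
    ℕ ⊨ boundedArithToPV.onTheory T ↔ ℕ ⊨ T :=
  LHom.onTheory_model (M := ℕ) boundedArithToPV T

/-- The embedding `L(S₂) →ᴸ L(PV)` is injective on symbols (Mathlib `LHom.Injective`): distinct
Buss symbols go to distinct `PV` symbols (`S` goes to a composite, all others to distinct
constructors). [folklore] -/
theorem boundedArithToPV_injective : boundedArithToPV.Injective where
  onFunction := by
    intro n a b h
    cases a <;> cases b <;> first | rfl | (exact absurd h (by simp [boundedArithToPV,
      Literature.Computability.MetaComplexity.BoundedArithFunc.toPV, PVFun.succ]))
  onRelation := by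
    intro n a b _
    cases a; cases b; rfl

/-! ## Term formers of `L(PV)` -/

section Term

variable {α : Type} {n m : ℕ}

/-- The `L(PV)`-term `f(t₀, …, tₘ₋₁)` for a `PV` symbol `f : PVFun m` (Mathlib `Term.func`;
Cook 1975, §2). [cite: Cook1975, §2] -/
abbrev pvApp (f : PVFun m) (ts : Fin m → Language.pv.Term α) : Language.pv.Term α :=
  Term.func f ts

/-- The constant term `0` of `L(PV)` (Cook 1975, §2). [cite: Cook1975, §2] -/
instance : Zero (Language.pv.Term α) where
  zero := Constants.term (L := Language.pv) PVFun.zero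

/-- The term `t₁ + t₂` of `L(PV)` (Buss 1986, Ch. 6). [cite: Buss1986, Ch. 6] -/
instance : Add (Language.pv.Term α) where
  add := Functions.apply₂ (L := Language.pv) PVFun.add

/-- The term `t₁ · t₂` of `L(PV)` (Buss 1986, Ch. 6). [cite: Buss1986, Ch. 6] -/
instance : Mul (Language.pv.Term α) where
  mul := Functions.apply₂ (L := Language.pv) PVFun.mul

/-- The binary-successor term `s_b t = 2t + b` of `L(PV)` (Cook 1975, §2). [cite: Cook1975, §2] -/
def pvBit (b : Bool) (t : Language.pv.Term α) : Language.pv.Term α :=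
  Functions.apply₁ (L := Language.pv) (PVFun.bit b) t

/-- Buss's successor term `S t` of `L(PV)`, via the derived symbol `PVFun.succ`
(Buss 1986, Ch. 6). [cite: Buss1986, Ch. 6] -/
def pvSucc (t : Language.pv.Term α) : Language.pv.Term α :=
  Functions.apply₁ (L := Language.pv) PVFun.succ t

/-- The halving term `⌊t/2⌋` of `L(PV)` (Cook 1975 `TR`; Buss 1986, Ch. 6). [cite: Cook1975, TR] -/
def pvHalf (t : Language.pv.Term α) : Language.pv.Term α :=
  Functions.apply₁ (L := Language.pv) PVFun.half t

/-- The length term `|t|` of `L(PV)` (Buss 1986, Ch. 6). [cite: Buss1986, Ch. 6] -/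
def pvLen (t : Language.pv.Term α) : Language.pv.Term α :=
  Functions.apply₁ (L := Language.pv) PVFun.len t

/-- The smash term `t₁ # t₂` of `L(PV)` (Buss 1986, Ch. 6). [cite: Buss1986, Ch. 6] -/
def pvSmash (t₁ t₂ : Language.pv.Term α) : Language.pv.Term α :=
  Functions.apply₂ (L := Language.pv) PVFun.smash t₁ t₂

/-- The conditional term `cond(t₁, t₂, t₃)` of `L(PV)` (Cobham 1965; Buss 1986, Ch. 6). [cite: Cobham1965] -/
def pvCond (t₁ t₂ t₃ : Language.pv.Term α) : Language.pv.Term α :=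
  pvApp PVFun.cond ![t₁, t₂, t₃]

variable (v : α → ℕ) (t t₁ t₂ t₃ : Language.pv.Term α)

/-- Semantics of `0` in `ℕ` (Cook 1975, §2). [cite: Cook1975, §2] -/
@[simp] theorem realize_pv_zero : (0 : Language.pv.Term α).realize v = 0 := rfl

/-- Semantics of `+` in `ℕ` (Buss 1986, Ch. 6). [cite: Buss1986, Ch. 6] -/
@[simp] theorem realize_pv_add : (t₁ + t₂).realize v = t₁.realize v + t₂.realize v := rfl

/-- Semantics of `·` in `ℕ` (Buss 1986, Ch. 6). [cite: Buss1986, Ch. 6] -/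
@[simp] theorem realize_pv_mul : (t₁ * t₂).realize v = t₁.realize v * t₂.realize v := rfl

/-- Semantics of `s_b` in `ℕ` (Cook 1975, §2). [cite: Cook1975, §2] -/
@[simp] theorem realize_pvBit (b : Bool) : (pvBit b t).realize v = Nat.bit b (t.realize v) :=
  rfl

/-- Semantics of `S` in `ℕ` (Buss 1986, Ch. 6; `PVFun.eval_succ`). [cite: Buss1986, Ch. 6] -/
@[simp] theorem realize_pvSucc : (pvSucc t).realize v = t.realize v + 1 := by
  simp [pvSucc, Functions.apply₁]

/-- Semantics of `⌊·/2⌋` in `ℕ` (Buss 1986, Ch. 6). [cite: Buss1986, Ch. 6] -/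
@[simp] theorem realize_pvHalf : (pvHalf t).realize v = t.realize v / 2 := rfl

/-- Semantics of `|·|` in `ℕ` (Buss 1986, Ch. 6). [cite: Buss1986, Ch. 6] -/
@[simp] theorem realize_pvLen : (pvLen t).realize v = Nat.size (t.realize v) := rfl

/-- Semantics of `#` in `ℕ` (Buss 1986, Ch. 6). [cite: Buss1986, Ch. 6] -/
@[simp] theorem realize_pvSmash :
    (pvSmash t₁ t₂).realize v = 2 ^ (Nat.size (t₁.realize v) * Nat.size (t₂.realize v)) := rfl

/-- Semantics of `cond` in `ℕ` (Cobham 1965). [cite: Cobham1965] -/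
@[simp] theorem realize_pvCond :
    (pvCond t₁ t₂ t₃).realize v = if t₁.realize v = 0 then t₂.realize v else t₃.realize v :=
  rfl

end Term

/-! ## Generic syntactic facts about language maps

Small structural lemmas about `LHom.onTerm` / `LHom.onBoundedFormula` missing from Mathlib
(grep `onTerm_relabel`, `IsQF.onBoundedFormula`: no hits).  They are deliberately placed in
Mathlib's `FirstOrder.Language.LHom` / `FirstOrder.Language.BoundedFormula.IsQF` namespaces as
dot-notation extensions. -/

section LHom

variable {L L' : Language} (g : L →ᴸ L') {β γ : Type} {l : ℕ}

/-- Language maps commute with relabelling of terms (structural induction; Mathlib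
`LHom.onTerm`, `Term.relabel`).  Dot-notation extension of Mathlib's `LHom` namespace. [folklore] -/
theorem _root_.FirstOrder.Language.LHom.onTerm_relabel (r : β → γ) (t : L.Term β) :
    g.onTerm (t.relabel r) = (g.onTerm t).relabel r := by
  induction t with
  | var => rfl
  | func f ts ih => simp [Term.relabel, ih]

/-- Language maps commute with `∼` (definitional; Mathlib `LHom.onBoundedFormula`).
Dot-notation extension of Mathlib's `LHom` namespace. [folklore] -/
theorem _root_.FirstOrder.Language.LHom.onBoundedFormula_not (φ : L.BoundedFormula β l) :
    g.onBoundedFormula (∼φ) = ∼(g.onBoundedFormula φ) := rfl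

/-- Language maps commute with `⊓` (definitional; Mathlib `LHom.onBoundedFormula`).
Dot-notation extension of Mathlib's `LHom` namespace. [folklore] -/
theorem _root_.FirstOrder.Language.LHom.onBoundedFormula_inf (φ ψ : L.BoundedFormula β l) :
    g.onBoundedFormula (φ ⊓ ψ) = g.onBoundedFormula φ ⊓ g.onBoundedFormula ψ := rfl

/-- Language maps commute with `∃'` (definitional; Mathlib `LHom.onBoundedFormula`).
Dot-notation extension of Mathlib's `LHom` namespace. [folklore] -/
theorem _root_.FirstOrder.Language.LHom.onBoundedFormula_ex (φ : L.BoundedFormula β (l + 1)) :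
    g.onBoundedFormula (∃' φ) = ∃' (g.onBoundedFormula φ) :=
  rfl

/-- Language maps preserve quantifier-freeness (structural; Mathlib `BoundedFormula.IsQF`).
Dot-notation extension of Mathlib's `BoundedFormula.IsQF` namespace. [folklore] -/
theorem _root_.FirstOrder.Language.BoundedFormula.IsQF.onBoundedFormula
    {φ : L.BoundedFormula β l} (h : φ.IsQF) : (g.onBoundedFormula φ).IsQF := by
  induction h with
  | falsum => exact .falsum
  | of_isAtomic h =>
    cases h with
    | equal t₁ t₂ => exact .of_isAtomic (.equal _ _)
    | rel R ts => exact .of_isAtomic (.rel _ _)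
  | imp _ _ ih₁ ih₂ => exact ih₁.imp ih₂

end LHom

/-! ## Sharply bounded quantifiers and the `Σᵇᵢ(PV) / Πᵇᵢ(PV)` hierarchy -/

section Hierarchy

variable {α : Type}

/-- The sharply bounded universal quantifier `(∀ x ≤ |t|) φ` of `L(PV)`, `t` an arbitrary
`L(PV)`-term not containing `x` (Buss 1986, Ch. 6; G14 `ballLE`). [cite: Buss1986, Ch. 6] -/
def ballLELenPV {n : ℕ} (t : Language.pv.Term (α ⊕ Fin n))
    (φ : Language.pv.BoundedFormula α (n + 1)) : Language.pv.BoundedFormula α n :=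
  Literature.Computability.MetaComplexity.ballLE (pvLen t) φ

/-- The sharply bounded existential quantifier `(∃ x ≤ |t|) φ` of `L(PV)` (Buss 1986, Ch. 6;
G14 `bexLE`). [cite: Buss1986, Ch. 6] -/
def bexLELenPV {n : ℕ} (t : Language.pv.Term (α ⊕ Fin n))
    (φ : Language.pv.BoundedFormula α (n + 1)) : Language.pv.BoundedFormula α n :=
  Literature.Computability.MetaComplexity.bexLE (pvLen t) φ

/-- Semantics of `(∀ x ≤ |t|) φ` in `ℕ` (Buss 1986, Ch. 6). [cite: Buss1986, Ch. 6] -/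
@[simp] theorem realize_ballLELenPV {n : ℕ} (t : Language.pv.Term (α ⊕ Fin n))
    (φ : Language.pv.BoundedFormula α (n + 1)) (v : α → ℕ) (xs : Fin n → ℕ) :
    (ballLELenPV t φ).Realize v xs ↔
      ∀ a ≤ Nat.size (t.realize (Sum.elim v xs)), φ.Realize v (Fin.snoc xs a) := by
  simp [ballLELenPV]

/-- Semantics of `(∃ x ≤ |t|) φ` in `ℕ` (Buss 1986, Ch. 6). [cite: Buss1986, Ch. 6] -/
@[simp] theorem realize_bexLELenPV {n : ℕ} (t : Language.pv.Term (α ⊕ Fin n))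
    (φ : Language.pv.BoundedFormula α (n + 1)) (v : α → ℕ) (xs : Fin n → ℕ) :
    (bexLELenPV t φ).Realize v xs ↔
      ∃ a ≤ Nat.size (t.realize (Sum.elim v xs)), φ.Realize v (Fin.snoc xs a) := by
  simp [bexLELenPV]

/-- Sharply bounded `L(PV)`-formulas (`Σᵇ₀(PV) = Πᵇ₀(PV)`): the least class containing the open
formulas and closed under the connectives and the sharply bounded quantifiers `(∀ x ≤ |t|)`,
`(∃ x ≤ |t|)`, `t` any `L(PV)`-term (Buss 1986, §2.1 and Ch. 6; Krajíček 1995, §5.3).  Same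
clauses as G14 `IsSharplyBounded`. [cite: Buss1986, §2.1 and Ch. 6] -/
inductive IsSharplyBoundedPV : ∀ {n : ℕ}, Language.pv.BoundedFormula α n → Prop
  | of_isQF {n : ℕ} {φ : Language.pv.BoundedFormula α n} (h : φ.IsQF) : IsSharplyBoundedPV φ
  | imp {n : ℕ} {φ ψ : Language.pv.BoundedFormula α n} (hφ : IsSharplyBoundedPV φ)
      (hψ : IsSharplyBoundedPV ψ) : IsSharplyBoundedPV (φ ⟹ ψ)
  | ballLELenPV {n : ℕ} (t : Language.pv.Term (α ⊕ Fin n))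
      {φ : Language.pv.BoundedFormula α (n + 1)} (hφ : IsSharplyBoundedPV φ) :
      IsSharplyBoundedPV (ballLELenPV t φ)
  | bexLELenPV {n : ℕ} (t : Language.pv.Term (α ⊕ Fin n))
      {φ : Language.pv.BoundedFormula α (n + 1)} (hφ : IsSharplyBoundedPV φ) :
      IsSharplyBoundedPV (bexLELenPV t φ)

mutual
/-- The class `Σᵇᵢ(PV)` of bounded `L(PV)`-formulas (Buss 1986, §2.1 relativised to `L(PV)`,
Ch. 6; Krajíček 1995, §5.3): the clauses of G14 `IsSigmab` verbatim, with bounding terms now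
arbitrary `L(PV)`-terms not containing the bound variable.  `Σᵇ₀(PV)` = sharply bounded;
`Σᵇᵢ₊₁(PV)` contains `Πᵇᵢ(PV)` and is closed under `(∃ x ≤ t)`, `(∀ x ≤ |t|)` and (via the
single clause `imp` on Mathlib's primitive syntax) `∧`, `∨`, negated `Πᵇᵢ₊₁(PV)`. [cite: Buss1986, §2.1 relativised to  L(PV] -/
inductive IsSigmabPV : ℕ → ∀ {n : ℕ}, Language.pv.BoundedFormula α n → Prop
  | of_isSharplyBoundedPV {i n : ℕ} {φ : Language.pv.BoundedFormula α n}
      (h : IsSharplyBoundedPV φ) : IsSigmabPV i φ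
  | of_isPibPV {i n : ℕ} {φ : Language.pv.BoundedFormula α n} (h : IsPibPV i φ) :
      IsSigmabPV (i + 1) φ
  | imp {i n : ℕ} {φ ψ : Language.pv.BoundedFormula α n} (hφ : IsPibPV (i + 1) φ)
      (hψ : IsSigmabPV (i + 1) ψ) : IsSigmabPV (i + 1) (φ ⟹ ψ)
  | bexLE {i n : ℕ} (t : Language.pv.Term (α ⊕ Fin n))
      {φ : Language.pv.BoundedFormula α (n + 1)} (hφ : IsSigmabPV (i + 1) φ) :
      IsSigmabPV (i + 1) (Literature.Computability.MetaComplexity.bexLE t φ)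
  | ballLELenPV {i n : ℕ} (t : Language.pv.Term (α ⊕ Fin n))
      {φ : Language.pv.BoundedFormula α (n + 1)} (hφ : IsSigmabPV (i + 1) φ) :
      IsSigmabPV (i + 1) (ballLELenPV t φ)
/-- The class `Πᵇᵢ(PV)` of bounded `L(PV)`-formulas, dual to `IsSigmabPV` (Buss 1986, §2.1,
Ch. 6; Krajíček 1995, §5.3): the clauses of G14 `IsPib` verbatim over `L(PV)`. [cite: Buss1986, §2.1  Ch. 6] -/
inductive IsPibPV : ℕ → ∀ {n : ℕ}, Language.pv.BoundedFormula α n → Prop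
  | of_isSharplyBoundedPV {i n : ℕ} {φ : Language.pv.BoundedFormula α n}
      (h : IsSharplyBoundedPV φ) : IsPibPV i φ
  | of_isSigmabPV {i n : ℕ} {φ : Language.pv.BoundedFormula α n} (h : IsSigmabPV i φ) :
      IsPibPV (i + 1) φ
  | imp {i n : ℕ} {φ ψ : Language.pv.BoundedFormula α n} (hφ : IsSigmabPV (i + 1) φ)
      (hψ : IsPibPV (i + 1) ψ) : IsPibPV (i + 1) (φ ⟹ ψ)
  | ballLE {i n : ℕ} (t : Language.pv.Term (α ⊕ Fin n))
      {φ : Language.pv.BoundedFormula α (n + 1)} (hφ : IsPibPV (i + 1) φ) :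
      IsPibPV (i + 1) (Literature.Computability.MetaComplexity.ballLE t φ)
  | bexLELenPV {i n : ℕ} (t : Language.pv.Term (α ⊕ Fin n))
      {φ : Language.pv.BoundedFormula α (n + 1)} (hφ : IsPibPV (i + 1) φ) :
      IsPibPV (i + 1) (bexLELenPV t φ)
end

/-- `∀Σᵇᵢ(PV)` sentences: universal closures `∀ x₁ ⋯ ∀ xₙ ψ` of `Σᵇᵢ(PV)` formulas `ψ`, the
class for which "`S₂¹(PV)` is conservative over `PV₁`" is stated (Buss 1986, Ch. 6;
Krajíček 1995, §5.3).  Same shape as G14 `IsForallSigmab`. [cite: Buss1986, Ch. 6] -/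
def IsForallSigmabPV (i : ℕ) (φ : Language.pv.Sentence) : Prop :=
  ∃ (n : ℕ) (ψ : Language.pv.BoundedFormula Empty n), IsSigmabPV i ψ ∧ φ = ψ.alls

/-- The family of `Σᵇᵢ(PV)` formulas with free variables `Fin (k+1)` (`k` parameters and one
induction variable), for use in the schemes (Buss 1986, §2.4, Ch. 6; as G14 `sigmabFormulas`). [cite: Buss1986, §2.4  Ch. 6] -/
def sigmabPVFormulas (i : ℕ) : ∀ k, Set (Language.pv.Formula (Fin (k + 1))) :=
  fun _ => {φ | IsSigmabPV i φ}

/-- The family of open (quantifier-free) `L(PV)`-formulas with free variables `Fin (k+1)`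
(Mathlib `BoundedFormula.IsQF`; the induction formulas of `PV₁`, Krajíček 1995, Def. 5.3.1). [folklore] -/
def openFormulas : ∀ k, Set (Language.pv.Formula (Fin (k + 1))) :=
  fun _ => {φ | φ.IsQF}

variable {n : ℕ}

/-- Sharply bounded `L(PV)`-formulas are exactly the `Σᵇ₀(PV)` formulas (Buss 1986, Ch. 6). [cite: Buss1986, Ch. 6] -/
theorem IsSharplyBoundedPV.isSigmabPV_zero {φ : Language.pv.BoundedFormula α n} :
    IsSigmabPV 0 φ ↔ IsSharplyBoundedPV φ :=
  ⟨fun h => by cases h; assumption, .of_isSharplyBoundedPV⟩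

/-- Open `L(PV)`-formulas are `Σᵇᵢ(PV)` for every `i` (Buss 1986, Ch. 6: open ⊆ `Σᵇ₀(PV)`). [cite: Buss1986, Ch. 6: open ⊆  Σᵇ₀(PV] -/
theorem IsSigmabPV.of_isQF {i : ℕ} {φ : Language.pv.BoundedFormula α n} (h : φ.IsQF) :
    IsSigmabPV i φ :=
  .of_isSharplyBoundedPV (.of_isQF h)

/-- `Πᵇᵢ(PV) ⊆ Σᵇᵢ₊₁(PV)` (Buss 1986, §2.1, Ch. 6). [cite: Buss1986, §2.1  Ch. 6] -/
theorem IsPibPV.isSigmabPV_succ {i : ℕ} {φ : Language.pv.BoundedFormula α n}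
    (h : IsPibPV i φ) : IsSigmabPV (i + 1) φ :=
  .of_isPibPV h

/-- `Σᵇᵢ(PV) ⊆ Πᵇᵢ₊₁(PV)` (Buss 1986, §2.1, Ch. 6). [cite: Buss1986, §2.1  Ch. 6] -/
theorem IsSigmabPV.isPibPV_succ {i : ℕ} {φ : Language.pv.BoundedFormula α n}
    (h : IsSigmabPV i φ) : IsPibPV (i + 1) φ :=
  .of_isSigmabPV h

/-- The hierarchy `Σᵇᵢ(PV)` is cumulative (Buss 1986, §2.1, Ch. 6). [cite: Buss1986, §2.1  Ch. 6] -/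
def IsSigmabPV.mono : Prop :=
  ∀ {i j : ℕ} (hij : i ≤ j) {φ : Language.pv.BoundedFormula α n} (h : IsSigmabPV i φ),
    IsSigmabPV j φ

/-- The hierarchy `Πᵇᵢ(PV)` is cumulative (Buss 1986, §2.1, Ch. 6; as G14 `IsPib.mono`). [cite: Buss1986, §2.1  Ch. 6] -/
def IsPibPV.mono : Prop :=
  ∀ {i j : ℕ} (hij : i ≤ j) {φ : Language.pv.BoundedFormula α n} (h : IsPibPV i φ),
    IsPibPV j φ

/-- Open formulas are `Σᵇᵢ(PV)` formulas, as families for the schemes (Buss 1986, Ch. 6). [cite: Buss1986, Ch. 6] -/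
theorem openFormulas_subset_sigmabPVFormulas (i k : ℕ) :
    openFormulas k ⊆ sigmabPVFormulas i k :=
  fun _ h => IsSigmabPV.of_isQF h

/-- The families `Σᵇᵢ(PV)` are cumulative in `i` (Buss 1986, Ch. 6). [cite: Buss1986, Ch. 6] -/
def sigmabPVFormulas_mono : Prop :=
  ∀ {i j : ℕ} (hij : i ≤ j) (k : ℕ),
    sigmabPVFormulas i k ⊆ sigmabPVFormulas j k

/- interim proof relied on results that are now named facts (D-0014); demoted to a fact by the M5 import, proof preserved:
:=
  fun _ h => IsSigmabPV.mono hij h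
-/

/-- The embedding (which is the identity on `≤`) commutes with the atomic formula former
`Term.le` (syntactic). [folklore] -/
theorem onBoundedFormula_le {l : ℕ} (t₁ t₂ : Language.boundedArith.Term (α ⊕ Fin l)) :
    boundedArithToPV.onBoundedFormula (t₁.le t₂) =
      (boundedArithToPV.onTerm t₁).le (boundedArithToPV.onTerm t₂) := by
  simp only [Term.le, Relations.boundedFormula₂, Relations.boundedFormula,
    LHom.onBoundedFormula]
  congr 1
  funext i
  fin_cases i <;> rfl

/-- The embedding commutes with the bounded universal quantifier former `ballLE`
(syntactic; used for `IsSigmab.onBoundedFormula`). [folklore] -/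
theorem onBoundedFormula_ballLE (t : Language.boundedArith.Term (α ⊕ Fin n))
    (φ : Language.boundedArith.BoundedFormula α (n + 1)) :
    boundedArithToPV.onBoundedFormula (Literature.Computability.MetaComplexity.ballLE t φ) =
      Literature.Computability.MetaComplexity.ballLE (boundedArithToPV.onTerm t) (boundedArithToPV.onBoundedFormula φ) := by
  rw [Literature.Computability.MetaComplexity.ballLE, Literature.Computability.MetaComplexity.ballLE, ← LHom.onTerm_relabel]
  simp only [LHom.onBoundedFormula, onBoundedFormula_le, LHom.onTerm, Function.comp_apply]

/-- The embedding commutes with the bounded existential quantifier former `bexLE`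
(syntactic; used for `IsSigmab.onBoundedFormula`). [folklore] -/
theorem onBoundedFormula_bexLE (t : Language.boundedArith.Term (α ⊕ Fin n))
    (φ : Language.boundedArith.BoundedFormula α (n + 1)) :
    boundedArithToPV.onBoundedFormula (Literature.Computability.MetaComplexity.bexLE t φ) =
      Literature.Computability.MetaComplexity.bexLE (boundedArithToPV.onTerm t) (boundedArithToPV.onBoundedFormula φ) := by
  rw [Literature.Computability.MetaComplexity.bexLE, Literature.Computability.MetaComplexity.bexLE, ← LHom.onTerm_relabel, LHom.onBoundedFormula_ex,
    LHom.onBoundedFormula_inf, onBoundedFormula_le]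
  simp only [LHom.onTerm, Function.comp_apply]

/-- The embedding sends `|t|` to `|t|` (syntactic). [folklore] -/
theorem onTerm_len (t : Language.boundedArith.Term α) :
    boundedArithToPV.onTerm (Literature.Computability.MetaComplexity.Term.len t) = pvLen (boundedArithToPV.onTerm t) := by
  simp only [Literature.Computability.MetaComplexity.Term.len, pvLen, Functions.apply₁, LHom.onTerm]
  congr 1
  funext i
  fin_cases i; rfl

/-- The embedding commutes with the sharply bounded universal quantifier (syntactic). [folklore] -/
theorem onBoundedFormula_ballLELen (t : Language.boundedArith.Term (α ⊕ Fin n))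
    (φ : Language.boundedArith.BoundedFormula α (n + 1)) :
    boundedArithToPV.onBoundedFormula (Literature.Computability.MetaComplexity.ballLELen t φ) =
      ballLELenPV (boundedArithToPV.onTerm t) (boundedArithToPV.onBoundedFormula φ) := by
  rw [Literature.Computability.MetaComplexity.ballLELen, ballLELenPV, onBoundedFormula_ballLE, onTerm_len]

/-- The embedding commutes with the sharply bounded existential quantifier (syntactic). [folklore] -/
theorem onBoundedFormula_bexLELen (t : Language.boundedArith.Term (α ⊕ Fin n))
    (φ : Language.boundedArith.BoundedFormula α (n + 1)) :
    boundedArithToPV.onBoundedFormula (Literature.Computability.MetaComplexity.bexLELen t φ) =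
      bexLELenPV (boundedArithToPV.onTerm t) (boundedArithToPV.onBoundedFormula φ) := by
  rw [Literature.Computability.MetaComplexity.bexLELen, bexLELenPV, onBoundedFormula_bexLE, onTerm_len]

/-- Translations of sharply bounded formulas are sharply bounded `L(PV)`-formulas
(Buss 1986, Ch. 6). [cite: Buss1986, Ch. 6] -/
theorem _root_.Literature.Computability.MetaComplexity.IsSharplyBounded.onBoundedFormula {φ : Language.boundedArith.BoundedFormula α n}
    (h : Literature.Computability.MetaComplexity.IsSharplyBounded φ) : IsSharplyBoundedPV (boundedArithToPV.onBoundedFormula φ) := by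
  induction h with
  | of_isQF h => exact .of_isQF (h.onBoundedFormula _)
  | imp _ _ ih₁ ih₂ => exact .imp ih₁ ih₂
  | ballLELen t _ ih => rw [onBoundedFormula_ballLELen]; exact .ballLELenPV _ ih
  | bexLELen t _ ih => rw [onBoundedFormula_bexLELen]; exact .bexLELenPV _ ih

/-- The translation of Buss's `Σᵇᵢ` formulas are `Σᵇᵢ(PV)` formulas (Buss 1986, Ch. 6:
`Σᵇᵢ ⊆ Σᵇᵢ(PV)`; by simultaneous induction over `IsSigmab`/`IsPib`, the language map commuting
with `ballLE`, `bexLE`, `Term.len`). [cite: Buss1986, Ch. 6:  Σᵇᵢ ⊆ Σᵇᵢ(PV] -/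
theorem _root_.Literature.Computability.MetaComplexity.IsSigmab.onBoundedFormula {i : ℕ} {φ : Language.boundedArith.BoundedFormula α n}
    (h : Literature.Computability.MetaComplexity.IsSigmab i φ) : IsSigmabPV i (boundedArithToPV.onBoundedFormula φ) := by
  refine @Literature.Computability.MetaComplexity.IsSigmab.rec α
    (fun i {n} φ _ => IsSigmabPV i (boundedArithToPV.onBoundedFormula φ))
    (fun i {n} φ _ => IsPibPV i (boundedArithToPV.onBoundedFormula φ))
    ?_ ?_ ?_ ?_ ?_ ?_ ?_ ?_ ?_ ?_ i n φ h
  · exact fun h => .of_isSharplyBoundedPV h.onBoundedFormula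
  · exact fun _ ih => .of_isPibPV ih
  · exact fun _ _ ih₁ ih₂ => .imp ih₁ ih₂
  · intro i n t φ _ ih; rw [onBoundedFormula_bexLE]; exact .bexLE _ ih
  · intro i n t φ _ ih; rw [onBoundedFormula_ballLELen]; exact .ballLELenPV _ ih
  · exact fun h => .of_isSharplyBoundedPV h.onBoundedFormula
  · exact fun _ ih => .of_isSigmabPV ih
  · exact fun _ _ ih₁ ih₂ => .imp ih₁ ih₂
  · intro i n t φ _ ih; rw [onBoundedFormula_ballLE]; exact .ballLE _ ih
  · intro i n t φ _ ih; rw [onBoundedFormula_bexLELen]; exact .bexLELenPV _ ih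

/-- The translation of Buss's `Πᵇᵢ` formulas are `Πᵇᵢ(PV)` formulas (Buss 1986, Ch. 6). [cite: Buss1986, Ch. 6] -/
theorem _root_.Literature.Computability.MetaComplexity.IsPib.onBoundedFormula {i : ℕ} {φ : Language.boundedArith.BoundedFormula α n}
    (h : Literature.Computability.MetaComplexity.IsPib i φ) : IsPibPV i (boundedArithToPV.onBoundedFormula φ) := by
  refine @Literature.Computability.MetaComplexity.IsPib.rec α
    (fun i {n} φ _ => IsSigmabPV i (boundedArithToPV.onBoundedFormula φ))
    (fun i {n} φ _ => IsPibPV i (boundedArithToPV.onBoundedFormula φ))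
    ?_ ?_ ?_ ?_ ?_ ?_ ?_ ?_ ?_ ?_ i n φ h
  · exact fun h => .of_isSharplyBoundedPV h.onBoundedFormula
  · exact fun _ ih => .of_isPibPV ih
  · exact fun _ _ ih₁ ih₂ => .imp ih₁ ih₂
  · intro i n t φ _ ih; rw [onBoundedFormula_bexLE]; exact .bexLE _ ih
  · intro i n t φ _ ih; rw [onBoundedFormula_ballLELen]; exact .ballLELenPV _ ih
  · exact fun h => .of_isSharplyBoundedPV h.onBoundedFormula
  · exact fun _ ih => .of_isSigmabPV ih
  · exact fun _ _ ih₁ ih₂ => .imp ih₁ ih₂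
  · intro i n t φ _ ih; rw [onBoundedFormula_ballLE]; exact .ballLE _ ih
  · intro i n t φ _ ih; rw [onBoundedFormula_bexLELen]; exact .bexLELenPV _ ih

end Hierarchy

/-- A sentence is *universal* if it is `∀ x₁ ⋯ ∀ xₙ ψ` with `ψ` quantifier-free.  Mathlib has
this notion as `BoundedFormula.IsUniversal` (`Mathlib/ModelTheory/Complexity.lean`), which we
use; the name is kept for the outline (Cook 1975, §3: the theorems of `PV₁` conservative over
`PV` are the universal ones; Krajíček 1995, §5.3). [cite: Cook1975, §3: the theorems of  PV₁  conservative o] -/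
abbrev IsUniversalSentence {L : Language} (φ : L.Sentence) : Prop :=
  BoundedFormula.IsUniversal φ

/-- Universal closures of open formulas are universal sentences (Mathlib
`BoundedFormula.IsUniversal`). [folklore] -/
theorem isUniversalSentence_alls {L : Language} {n : ℕ} {ψ : L.BoundedFormula Empty n}
    (h : ψ.IsQF) : IsUniversalSentence ψ.alls := by
  suffices H : ∀ {m} (χ : L.BoundedFormula Empty m), χ.IsUniversal → χ.alls.IsUniversal from
    H ψ h.isUniversal
  intro m χ hχ
  induction m with
  | zero => exact hχ
  | succ m ih => exact ih _ hχ.all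

/-! ## The defining axioms of the `PV` symbols -/

section Axioms

variable {n m : ℕ}

/-- The open formula "`f = min(a, c)`" over an ordered language, spelled with `≤`:
`(a ≤ c → f = a) ∧ (¬ a ≤ c → f = c)`; used to axiomatise the truncation by the bound `k` in
limited recursion on notation (Cobham 1965 side condition; Cook 1975, §2). [cite: Cobham1965, side condition] -/
def minFormula {L : Language} [L.IsOrdered] {α : Type} {l : ℕ} (f a c : L.Term (α ⊕ Fin l)) :
    L.BoundedFormula α l :=
  (a.le c ⟹ f =' a) ⊓ (∼(a.le c) ⟹ f =' c)

/-- Semantics of `minFormula` in an ordered structure whose `≤` symbol is interpreted by a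
linear order (Mathlib `Language.OrderedStructure`): it says `f = min a c`. [folklore] -/
theorem realize_minFormula {L : Language} [L.IsOrdered] {M : Type*} [LinearOrder M]
    [L.Structure M] [L.OrderedStructure M] {α : Type} {l : ℕ} (f a c : L.Term (α ⊕ Fin l))
    (v : α → M) (xs : Fin l → M) :
    (minFormula f a c).Realize v xs ↔
      f.realize (Sum.elim v xs) = min (a.realize (Sum.elim v xs)) (c.realize (Sum.elim v xs)) := by
  simp only [minFormula, BoundedFormula.realize_inf, BoundedFormula.realize_imp, Term.realize_le,
    BoundedFormula.realize_bdEqual, BoundedFormula.realize_not]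
  rcases le_total (a.realize (Sum.elim v xs)) (c.realize (Sum.elim v xs)) with h | h
  · simp only [h, min_eq_left h, forall_const, not_true_eq_false, IsEmpty.forall_iff, and_true]
  · rcases h.lt_or_eq with h' | h'
    · simp only [not_le.2 h', min_eq_right h, IsEmpty.forall_iff, not_false_eq_true,
        forall_const, true_and]
    · simp only [h', le_refl, min_self, forall_const, not_true_eq_false, IsEmpty.forall_iff,
        and_true]

/-- The `i`-th free variable `xᵢ` as an `L(PV)`-term of a formula with free variables `Fin n`
(Mathlib `Term.var ∘ Sum.inl`). [folklore] -/
abbrev fvar (i : Fin n) : Language.pv.Term (Fin n ⊕ Fin 0) :=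
  Term.var (Sum.inl i)

/-- The composition axiom `∀ x⃗, (f ∘ g⃗)(x⃗) = f(g₀(x⃗), …, gₘ₋₁(x⃗))`, the defining equation of
the symbol `PVFun.comp f g` (Cook 1975, §2, rule of composition; `PVFun.eval_comp`). [cite: Cook1975, §2  rule of composition] -/
def compAxiom (f : PVFun m) (g : Fin m → PVFun n) : Language.pv.Sentence :=
  Literature.Computability.MetaComplexity.closeFin (n := n) (pvApp (PVFun.comp f g) fvar =' pvApp f fun j => pvApp (g j) fvar)

/-- The projection axiom `∀ x⃗, πᵢ(x⃗) = xᵢ`, the defining equation of `PVFun.proj i`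
(Cobham 1965; Cook 1975, §2). [cite: Cobham1965] -/
def projAxiom (i : Fin n) : Language.pv.Sentence :=
  Literature.Computability.MetaComplexity.closeFin (n := n) (pvApp (PVFun.proj i) fvar =' fvar i)

/-- The base equation of limited recursion on notation for `F = limRec g h k`:
`∀ x⃗, F(x⃗, 0) = min(g(x⃗), k(x⃗, 0))`, `min` spelled by `minFormula`
(Cook 1975, §2; Cobham 1965; `PVFun.eval_limRec_zero`). [cite: Cook1975, §2] -/
def limRecZeroAxiom (g : PVFun n) (h : Bool → PVFun (n + 2)) (k : PVFun (n + 1)) :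
    Language.pv.Sentence :=
  Literature.Computability.MetaComplexity.closeFin (n := n)
    (minFormula
      (pvApp (PVFun.limRec g h k) (Fin.snoc (α := fun _ => Language.pv.Term _) fvar 0))
      (pvApp g fvar)
      (pvApp k (Fin.snoc (α := fun _ => Language.pv.Term _) fvar 0)))

/-- The step equation of limited recursion on notation for `F = limRec g h k` and the binary
successor `s_b`: `∀ x⃗ y, s_b y ≠ 0 → F(x⃗, s_b y) = min(h_b(x⃗, y, F(x⃗, y)), k(x⃗, s_b y))`
(Cook 1975, §2; Cobham 1965; `PVFun.eval_limRec_bit`).  Free variables `Fin (n+1)`: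
`x⃗ = castSucc`, `y = Fin.last n`. [cite: Cook1975, §2] -/
def limRecBitAxiom (b : Bool) (g : PVFun n) (h : Bool → PVFun (n + 2)) (k : PVFun (n + 1)) :
    Language.pv.Sentence :=
  let xs : Fin n → Language.pv.Term (Fin (n + 1) ⊕ Fin 0) := fun i => fvar (Fin.castSucc i)
  let y : Language.pv.Term (Fin (n + 1) ⊕ Fin 0) := fvar (Fin.last n)
  let F : Language.pv.Term (Fin (n + 1) ⊕ Fin 0) → Language.pv.Term (Fin (n + 1) ⊕ Fin 0) :=
    fun t => pvApp (PVFun.limRec g h k) (Fin.snoc (α := fun _ => Language.pv.Term _) xs t)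
  Literature.Computability.MetaComplexity.closeFin (n := n + 1)
    (∼(pvBit b y =' 0) ⟹
      minFormula (F (pvBit b y))
        (pvApp (h b) (Fin.snoc (α := fun _ => Language.pv.Term _)
          (Fin.snoc (α := fun _ => Language.pv.Term _) xs y) (F y)))
        (pvApp k (Fin.snoc (α := fun _ => Language.pv.Term _) xs (pvBit b y))))

open BoundedFormula in
/-- Defining equations of the initial `PV` symbols `s₀, s₁, ⌊·/2⌋, |·|, #, +, ·, cond` in the
style of (and partly overlapping with) Buss's `basicAxioms` (Cook 1975, §2, defining equations
of the initial functions; Buss 1986, §2.2 and Ch. 6).  Bound variables `x = &0`, `y = &1`,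
`z = &2`; `1 = S0 = pvSucc 0`.  In order:
`s₀x = x+x`, `s₁x = S(x+x)`, `⌊s₀x/2⌋ = x`, `⌊s₁x/2⌋ = x`, `⌊0/2⌋ = 0`, `|0| = 0`,
`s₀x ≠ 0 → |s₀x| = S|x|`, `|s₁x| = S|x|`, `x#0 = 1`, `s₀y ≠ 0 → x#s₀y = (x#y)·(1#x)`,
`x#s₁y = (x#y)·(1#x)`, `1#0 = 1`, `s₀y ≠ 0 → 1#s₀y = s₀(1#y)`, `1#s₁y = s₀(1#y)`, `x+0 = x`,
`x+Sy = S(x+y)`, `x·0 = 0`, `x·Sy = x·y+x`, `cond(0,y,z) = y`, `s₀x ≠ 0 → cond(s₀x,y,z) = z`,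
`cond(s₁x,y,z) = z`. [cite: Cook1975, §2  defining equations of the initial fu] -/
def initialAxioms : List Language.pv.Sentence :=
  [ alls (n := 1) (pvBit false &0 =' (&0 + &0)),
    alls (n := 1) (pvBit true &0 =' pvSucc (&0 + &0)),
    alls (n := 1) (pvHalf (pvBit false &0) =' &0),
    alls (n := 1) (pvHalf (pvBit true &0) =' &0),
    alls (n := 0) (pvHalf 0 =' 0),
    alls (n := 0) (pvLen 0 =' 0),
    alls (n := 1) (∼(pvBit false &0 =' 0) ⟹ (pvLen (pvBit false &0) =' pvSucc (pvLen &0))),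
    alls (n := 1) (pvLen (pvBit true &0) =' pvSucc (pvLen &0)),
    alls (n := 1) (pvSmash &0 0 =' pvSucc 0),
    alls (n := 2) (∼(pvBit false &1 =' 0) ⟹
      (pvSmash &0 (pvBit false &1) =' (pvSmash &0 &1 * pvSmash (pvSucc 0) &0))),
    alls (n := 2) (pvSmash &0 (pvBit true &1) =' (pvSmash &0 &1 * pvSmash (pvSucc 0) &0)),
    alls (n := 0) (pvSmash (pvSucc 0) 0 =' pvSucc 0),
    alls (n := 1) (∼(pvBit false &0 =' 0) ⟹
      (pvSmash (pvSucc 0) (pvBit false &0) =' pvBit false (pvSmash (pvSucc 0) &0))),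
    alls (n := 1) (pvSmash (pvSucc 0) (pvBit true &0) =' pvBit false (pvSmash (pvSucc 0) &0)),
    alls (n := 1) ((&0 + 0) =' &0),
    alls (n := 2) ((&0 + pvSucc &1) =' pvSucc (&0 + &1)),
    alls (n := 1) ((&0 * 0) =' 0),
    alls (n := 2) ((&0 * pvSucc &1) =' (&0 * &1 + &0)),
    alls (n := 3) (pvCond 0 &1 &2 =' &1),
    alls (n := 3) (∼(pvBit false &0 =' 0) ⟹ (pvCond (pvBit false &0) &1 &2 =' &2)),
    alls (n := 3) (pvCond (pvBit true &0) &1 &2 =' &2) ]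

/-- The defining axioms `PVdef` of the `PV` symbols as an `L(PV)`-theory: the initial
equations `initialAxioms`, all projection and composition axioms, and both recursion equations
of every `limRec g h k` (Cook 1975, §2, axioms of `PV` restricted to defining equations;
Krajíček 1995, Def. 5.3.1). [cite: Cook1975, §2  axioms of  PV  restricted to definin] -/
def PVdef : Language.pv.Theory :=
  {φ | φ ∈ initialAxioms} ∪
    (⋃ n, Set.range (projAxiom (n := n))) ∪
    (⋃ n, ⋃ m, Set.range fun p : PVFun m × (Fin m → PVFun n) => compAxiom p.1 p.2) ∪
    (⋃ n, Set.range fun p : PVFun n × (Bool → PVFun (n + 2)) × PVFun (n + 1) =>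
      limRecZeroAxiom p.1 p.2.1 p.2.2) ∪
    (⋃ n, Set.range fun p : Bool × PVFun n × (Bool → PVFun (n + 2)) × PVFun (n + 1) =>
      limRecBitAxiom p.1 p.2.1 p.2.2.1 p.2.2.2)

/-- `ℕ` satisfies every composition axiom (`PVFun.eval_comp`). [folklore] -/
theorem realize_compAxiom (f : PVFun m) (g : Fin m → PVFun n) : ℕ ⊨ compAxiom f g := by
  rw [compAxiom, Literature.Computability.MetaComplexity.realize_closeFin]
  intro v
  simp [Formula.Realize, Term.realize]

/-- `ℕ` satisfies every projection axiom (`PVFun.eval_proj`). [folklore] -/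
theorem realize_projAxiom (i : Fin n) : ℕ ⊨ projAxiom i := by
  rw [projAxiom, Literature.Computability.MetaComplexity.realize_closeFin]
  intro v
  simp [Formula.Realize, Term.realize]

/-- `ℕ` satisfies the base recursion equation (`PVFun.eval_limRec_zero`). [folklore] -/
theorem realize_limRecZeroAxiom (g : PVFun n) (h : Bool → PVFun (n + 2)) (k : PVFun (n + 1)) :
    ℕ ⊨ limRecZeroAxiom g h k := by
  rw [limRecZeroAxiom, Literature.Computability.MetaComplexity.realize_closeFin]
  intro v
  simp only [Formula.Realize, realize_minFormula, Term.realize_func, funMap_pv]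
  have hs : ∀ w : Fin 0 → ℕ, (fun i => Term.realize (Sum.elim v w)
      (Fin.snoc (α := fun _ => Language.pv.Term (Fin n ⊕ Fin 0)) fvar 0 i)) = Fin.snoc v 0 := by
    intro w; ext i; cases i using Fin.lastCases <;> simp
  have hv : ∀ w : Fin 0 → ℕ, (fun i => Term.realize (Sum.elim v w) (fvar i)) = v := by
    intro w; ext i; simp
  simp only [hs, hv, PVFun.eval_limRec_zero]

/-- `ℕ` satisfies the step recursion equation (`PVFun.eval_limRec_bit`). [folklore] -/
theorem realize_limRecBitAxiom (b : Bool) (g : PVFun n) (h : Bool → PVFun (n + 2))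
    (k : PVFun (n + 1)) : ℕ ⊨ limRecBitAxiom b g h k := by
  rw [limRecBitAxiom, Literature.Computability.MetaComplexity.realize_closeFin]
  intro v
  simp only [Formula.Realize, BoundedFormula.realize_imp, BoundedFormula.realize_not,
    BoundedFormula.realize_bdEqual, realize_minFormula, Term.realize_func, funMap_pv,
    realize_pvBit, realize_pv_zero]
  intro hne
  have hs : ∀ (w : Fin 0 → ℕ) (t : Language.pv.Term (Fin (n + 1) ⊕ Fin 0)),
      (fun i => Term.realize (Sum.elim v w)
        (Fin.snoc (α := fun _ => Language.pv.Term (Fin (n + 1) ⊕ Fin 0))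
          (fun i => fvar (Fin.castSucc i)) t i)) =
      Fin.snoc (fun i => v (Fin.castSucc i)) (t.realize (Sum.elim v w)) := by
    intro w t; ext i; cases i using Fin.lastCases <;> simp
  have hs2 : ∀ (w : Fin 0 → ℕ) (t : Language.pv.Term (Fin (n + 1) ⊕ Fin 0)),
      (fun i => Term.realize (Sum.elim v w)
        (Fin.snoc (α := fun _ => Language.pv.Term (Fin (n + 1) ⊕ Fin 0))
          (Fin.snoc (α := fun _ => Language.pv.Term (Fin (n + 1) ⊕ Fin 0))
            (fun i => fvar (Fin.castSucc i)) (fvar (Fin.last n))) t i)) =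
      Fin.snoc (Fin.snoc (fun i => v (Fin.castSucc i)) (v (Fin.last n)))
        (t.realize (Sum.elim v w)) := by
    intro w t; ext i
    cases i using Fin.lastCases with
    | last => simp
    | cast i => cases i using Fin.lastCases <;> simp
  simp only [hs, hs2, Term.realize_func, funMap_pv, realize_pvBit, Term.realize_var,
    Sum.elim_inl]
  rw [PVFun.eval_limRec_bit]
  intro hy
  by_contra hb
  apply hne
  cases b
  · simp [show v (Fin.last n) = 0 from hy]
  · exact absurd rfl hb

/-- `|2a| = |a| + 1` for `a ≠ 0` (Mathlib `Nat.size_bit`; Buss 1986, §2.2, axiom 10). [cite: Buss1986, §2.2  axiom 10] -/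
private theorem size_two_mul {a : ℕ} (h : a ≠ 0) : (2 * a).size = a.size + 1 := by
  have := Nat.size_bit (b := false) (n := a) (by simpa using h)
  simpa [Nat.bit_val] using this

/-- `|2a + 1| = |a| + 1` (Mathlib `Nat.size_bit`; Buss 1986, §2.2, axiom 10). [cite: Buss1986, §2.2  axiom 10] -/
private theorem size_two_mul_add_one (a : ℕ) : (2 * a + 1).size = a.size + 1 := by
  have := Nat.size_bit (b := true) (n := a) (by simp)
  simpa [Nat.bit_val] using this

/-- `ℕ` satisfies the initial equations `initialAxioms` (Cook 1975, §2). [cite: Cook1975, §2] -/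
theorem realize_of_mem_initialAxioms {φ : Language.pv.Sentence} (hφ : φ ∈ initialAxioms) :
    ℕ ⊨ φ := by
  simp only [initialAxioms, List.mem_cons, List.not_mem_nil, or_false] at hφ
  rcases hφ with rfl | rfl | rfl | rfl | rfl | rfl | rfl | rfl | rfl | rfl | rfl | rfl | rfl |
    rfl | rfl | rfl | rfl | rfl | rfl | rfl | rfl <;>
  simp [Sentence.Realize, Formula.Realize, BoundedFormula.alls, Fin.snoc] <;> intros <;>
  first
    | omega
    | simp_all [size_two_mul, size_two_mul_add_one, pow_succ', mul_add, pow_add]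

/-- The standard model `ℕ` is a model of `PVdef` (Cook 1975, §2: the defining equations are
true under the standard interpretation).  Stated as a theorem, not an instance. [cite: Cook1975, §2: the defining equations are true unde] -/
theorem model_nat_PVdef : ℕ ⊨ PVdef := by
  refine ⟨fun φ hφ => ?_⟩
  simp only [PVdef, Set.mem_union, Set.mem_setOf_eq, Set.mem_iUnion, Set.mem_range,
    Prod.exists] at hφ
  rcases hφ with (((hφ | ⟨n, i, rfl⟩) | ⟨n, m, f, g, rfl⟩) | ⟨n, g, h, k, rfl⟩) |
    ⟨n, b, g, h, k, rfl⟩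
  · exact realize_of_mem_initialAxioms hφ
  · exact realize_projAxiom i
  · exact realize_compAxiom f g
  · exact realize_limRecZeroAxiom g h k
  · exact realize_limRecBitAxiom b g h k

end Axioms

/-! ## Induction axioms over `L(PV)` and the theories `PV₁`, `S₂ⁱ(PV)`, `T₂ⁱ(PV)` -/

section Theories

variable {k : ℕ}

/-- The last free variable `x = Fin.last k` of an `L(PV)`-formula with free variables
`Fin (k+1)`, as a term (the induction variable; G14 `lastVar` over `L(PV)`). [folklore] -/
def pvLastVar : Language.pv.Term (Fin (k + 1)) :=
  Term.var (Fin.last k)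

/-- The polynomial induction axiom `PIND` for an `L(PV)`-formula `φ(p̄, x)`:
`∀ p̄ [ φ(0) ∧ ∀ x (φ(⌊x/2⌋) → φ(x)) → ∀ x φ(x) ]` (Buss 1986, §2.3 and Ch. 6; G14 `pindAxiom`
transcribed verbatim over `L(PV)`). [cite: Buss1986, §2.3 and Ch. 6] -/
def pvPindAxiom (φ : Language.pv.Formula (Fin (k + 1))) : Language.pv.Sentence :=
  Literature.Computability.MetaComplexity.closeFin
    ((Literature.Computability.MetaComplexity.instLast φ 0 ⊓ Literature.Computability.MetaComplexity.allLast (Literature.Computability.MetaComplexity.substLast φ (pvHalf pvLastVar) ⟹ φ)) ⟹ Literature.Computability.MetaComplexity.allLast φ)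

/-- The induction axiom `IND` for an `L(PV)`-formula `φ(p̄, x)`:
`∀ p̄ [ φ(0) ∧ ∀ x (φ(x) → φ(S x)) → ∀ x φ(x) ]` (Buss 1986, §2.3 and Ch. 6; G14 `indAxiom`
transcribed verbatim over `L(PV)`, `S` the derived symbol `PVFun.succ`). [cite: Buss1986, §2.3 and Ch. 6] -/
def pvIndAxiom (φ : Language.pv.Formula (Fin (k + 1))) : Language.pv.Sentence :=
  Literature.Computability.MetaComplexity.closeFin
    ((Literature.Computability.MetaComplexity.instLast φ 0 ⊓ Literature.Computability.MetaComplexity.allLast (φ ⟹ Literature.Computability.MetaComplexity.substLast φ (pvSucc pvLastVar))) ⟹ Literature.Computability.MetaComplexity.allLast φ)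

/-- Semantics of the induction variable term (Mathlib `Term.realize_var`). [folklore] -/
@[simp] theorem realize_pvLastVar (v : Fin (k + 1) → ℕ) :
    (pvLastVar : Language.pv.Term (Fin (k + 1))).realize v = v (Fin.last k) := rfl

/-- Every `IND` axiom over `L(PV)` is true in `ℕ` (ordinary induction; Buss 1986, §2.3). [cite: Buss1986, §2.3] -/
theorem realize_pvIndAxiom (φ : Language.pv.Formula (Fin (k + 1))) : ℕ ⊨ pvIndAxiom φ := by
  rw [pvIndAxiom, Literature.Computability.MetaComplexity.realize_closeFin]
  intro p
  simp only [Formula.realize_imp, Formula.realize_inf, Literature.Computability.MetaComplexity.realize_instLast, Literature.Computability.MetaComplexity.realize_allLast,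
    Literature.Computability.MetaComplexity.realize_substLast, realize_pvSucc, realize_pvLastVar, Fin.snoc_last, Fin.update_snoc_last,
    realize_pv_zero]
  rintro ⟨h0, hs⟩ a
  induction a with
  | zero => exact h0
  | succ a ih => exact hs a ih

/-- Every `PIND` axiom over `L(PV)` is true in `ℕ` (induction on binary notation, Mathlib
`Nat.binaryRec'`; Buss 1986, §2.3). [cite: Buss1986, §2.3] -/
theorem realize_pvPindAxiom (φ : Language.pv.Formula (Fin (k + 1))) : ℕ ⊨ pvPindAxiom φ := by
  rw [pvPindAxiom, Literature.Computability.MetaComplexity.realize_closeFin]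
  intro p
  simp only [Formula.realize_imp, Formula.realize_inf, Literature.Computability.MetaComplexity.realize_instLast, Literature.Computability.MetaComplexity.realize_allLast,
    Literature.Computability.MetaComplexity.realize_substLast, realize_pvHalf, realize_pvLastVar, Fin.snoc_last, Fin.update_snoc_last,
    realize_pv_zero]
  rintro ⟨h0, hs⟩ a
  induction a using Nat.binaryRec' with
  | zero => exact h0
  | bit b a _ ih =>
    refine hs _ ?_
    simpa [Nat.bit_div_two] using ih

/-- The theory `PV₁` (H21 rendering, '?'): the defining axioms `PVdef` of the `PV` symbols,
Buss's `BASIC` translated into `L(PV)`, and `PIND` for all open `L(PV)`-formulas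
(Krajíček–Pudlák–Takeuti 1991, §1; Krajíček 1995, Def. 5.3.1: "`PV₁` = `PV` + open `PIND`";
Buss 1986, §6.1; Cook 1975, §3 for the original `PV1`).  Alternative axiomatisation with the
same theorems (KPT 1991): the universal consequences of Cook's equational theory `PV`. [cite: PudlakTakeuti1991, §1] -/
def PV1 : Language.pv.Theory :=
  PVdef ∪ boundedArithToPV.onTheory Literature.Computability.MetaComplexity.BASIC ∪ ⋃ k, pvPindAxiom '' openFormulas k

/-- Buss's theory `S₂ⁱ(PV)`: `BASIC` (translated), the defining axioms of the `PV` symbols, and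
`PIND` for all `Σᵇᵢ(PV)` formulas of the extended language (Buss 1986, §2.4 and Ch. 6;
Krajíček 1995, §5.3). [cite: Buss1986, §2.4 and Ch. 6] -/
def S2PV (i : ℕ) : Language.pv.Theory :=
  boundedArithToPV.onTheory Literature.Computability.MetaComplexity.BASIC ∪ PVdef ∪ ⋃ k, pvPindAxiom '' sigmabPVFormulas i k

/-- Buss's theory `T₂ⁱ(PV)`: `BASIC` (translated), the defining axioms of the `PV` symbols, and
`IND` for all `Σᵇᵢ(PV)` formulas of the extended language (Buss 1986, §2.4 and Ch. 6;
Krajíček 1995, §5.3). [cite: Buss1986, §2.4 and Ch. 6] -/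
def T2PV (i : ℕ) : Language.pv.Theory :=
  boundedArithToPV.onTheory Literature.Computability.MetaComplexity.BASIC ∪ PVdef ∪ ⋃ k, pvIndAxiom '' sigmabPVFormulas i k

/-- `PVdef ⊆ PV₁` (by definition). [folklore] -/
theorem PVdef_subset_PV1 : PVdef ⊆ PV1 :=
  Set.subset_union_left.trans Set.subset_union_left

/-- `PVdef ⊆ S₂ⁱ(PV)` (by definition). [folklore] -/
theorem PVdef_subset_S2PV (i : ℕ) : PVdef ⊆ S2PV i :=
  Set.subset_union_right.trans Set.subset_union_left

/-- `PVdef ⊆ T₂ⁱ(PV)` (by definition). [folklore] -/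
theorem PVdef_subset_T2PV (i : ℕ) : PVdef ⊆ T2PV i :=
  Set.subset_union_right.trans Set.subset_union_left

/-- Translated `BASIC ⊆ S₂ⁱ(PV)` (by definition). [folklore] -/
theorem onTheory_BASIC_subset_S2PV (i : ℕ) : boundedArithToPV.onTheory Literature.Computability.MetaComplexity.BASIC ⊆ S2PV i :=
  Set.subset_union_left.trans Set.subset_union_left

/-- Translated `BASIC ⊆ T₂ⁱ(PV)` (by definition). [folklore] -/
theorem onTheory_BASIC_subset_T2PV (i : ℕ) : boundedArithToPV.onTheory Literature.Computability.MetaComplexity.BASIC ⊆ T2PV i :=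
  Set.subset_union_left.trans Set.subset_union_left

/-- `S₂ⁱ(PV) ⊆ S₂ʲ(PV)` for `i ≤ j`, axiom-wise (Buss 1986, §2.4, Ch. 6). [cite: Buss1986, §2.4  Ch. 6] -/
def S2PV_mono : Prop :=
  ∀ {i j : ℕ} (h : i ≤ j),
    S2PV i ⊆ S2PV j

/- interim proof relied on results that are now named facts (D-0014); demoted to a fact by the M5 import, proof preserved:
:=
  Set.union_subset_union_right _
    (Set.iUnion_mono fun k => Set.image_mono (sigmabPVFormulas_mono h k))
-/

/-- `T₂ⁱ(PV) ⊆ T₂ʲ(PV)` for `i ≤ j`, axiom-wise (Buss 1986, §2.4, Ch. 6; as G14 `T2_mono`). [cite: Buss1986, §2.4  Ch. 6] -/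
def T2PV_mono : Prop :=
  ∀ {i j : ℕ} (h : i ≤ j),
    T2PV i ⊆ T2PV j

/- interim proof relied on results that are now named facts (D-0014); demoted to a fact by the M5 import, proof preserved:
:=
  Set.union_subset_union_right _
    (Set.iUnion_mono fun k => Set.image_mono (sigmabPVFormulas_mono h k))
-/

/-- `PV₁ ⊆ S₂¹(PV)` axiom-wise: open formulas are `Σᵇ₁(PV)` (indeed `Σᵇ₀(PV)`)
(Buss 1986, §6.1). [cite: Buss1986, §6.1] -/
theorem PV1_subset_S2PV_one : PV1 ⊆ S2PV 1 := by
  refine Set.union_subset (Set.union_subset (PVdef_subset_S2PV 1)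
    (onTheory_BASIC_subset_S2PV 1)) (Set.subset_union_right.trans' ?_)
  exact Set.iUnion_mono fun k => Set.image_mono (openFormulas_subset_sigmabPVFormulas 1 k)

/-- `S₂¹(PV)` extends `PV₁` (Buss 1986, §6.1: `PV₁ ⊆ S₂¹(PV)`; here even axiom-wise, by
`PV1_subset_S2PV_one`). [cite: Buss1986, §6.1:  PV₁ ⊆ S₂¹(PV] -/
theorem S2PV_one_extends_PV1 : PV1.Extends (S2PV 1) :=
  .of_subset PV1_subset_S2PV_one

/-- The standard model `ℕ` is a model of `PV₁` (Cook 1975, §2–3; Buss 1986, Ch. 6).  Stated as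
a theorem, not an instance. [cite: Cook1975, §2–3] -/
def model_nat_PV1 : Prop :=
  ℕ ⊨ PV1

/- interim proof relied on results that are now named facts (D-0014); demoted to a fact by the M5 import, proof preserved:
:= by
  have hB : ℕ ⊨ boundedArithToPV.onTheory BASIC :=
    (model_nat_onTheory_boundedArithToPV_iff BASIC).2 model_nat_BASIC
  refine (model_nat_PVdef.union hB).union ⟨fun φ hφ => ?_⟩
  simp only [Set.mem_iUnion, Set.mem_image] at hφ
  obtain ⟨k, ψ, -, rfl⟩ := hφ
  exact realize_pvPindAxiom ψ
-/

/-- The standard model `ℕ` is a model of every `S₂ⁱ(PV)` (Buss 1986, Ch. 6).  Stated as a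
theorem, not an instance. [cite: Buss1986, Ch. 6] -/
def model_nat_S2PV : Prop :=
  ∀ (i : ℕ),
    ℕ ⊨ S2PV i

/- interim proof relied on results that are now named facts (D-0014); demoted to a fact by the M5 import, proof preserved:
:= by
  have hB : ℕ ⊨ boundedArithToPV.onTheory BASIC :=
    (model_nat_onTheory_boundedArithToPV_iff BASIC).2 model_nat_BASIC
  refine (hB.union model_nat_PVdef).union ⟨fun φ hφ => ?_⟩
  simp only [Set.mem_iUnion, Set.mem_image] at hφ
  obtain ⟨k, ψ, -, rfl⟩ := hφ
  exact realize_pvPindAxiom ψ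
-/

/-- The standard model `ℕ` is a model of every `T₂ⁱ(PV)` (Buss 1986, Ch. 6).  Stated as a
theorem, not an instance. [cite: Buss1986, Ch. 6] -/
def model_nat_T2PV : Prop :=
  ∀ (i : ℕ),
    ℕ ⊨ T2PV i

/- interim proof relied on results that are now named facts (D-0014); demoted to a fact by the M5 import, proof preserved:
:= by
  have hB : ℕ ⊨ boundedArithToPV.onTheory BASIC :=
    (model_nat_onTheory_boundedArithToPV_iff BASIC).2 model_nat_BASIC
  refine (hB.union model_nat_PVdef).union ⟨fun φ hφ => ?_⟩
  simp only [Set.mem_iUnion, Set.mem_image] at hφ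
  obtain ⟨k, ψ, -, rfl⟩ := hφ
  exact realize_pvIndAxiom ψ
-/

/-- `S₂ⁱ(PV)` extends the translation of `S₂ⁱ`: translated `BASIC` axioms are axioms of
`S₂ⁱ(PV)`, and the translation of a `Σᵇᵢ-PIND` axiom is the `PIND` axiom of the translated
(hence `Σᵇᵢ(PV)`, `IsSigmab.onBoundedFormula`) formula (Buss 1986, Ch. 6: `S₂ⁱ ⊆ S₂ⁱ(PV)`). [cite: Buss1986, Ch. 6:  S₂ⁱ ⊆ S₂ⁱ(PV] -/
def onTheory_S2_extends_S2PV : Prop :=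
  ∀ (i : ℕ),
    (boundedArithToPV.onTheory (Literature.Computability.MetaComplexity.S2 i)).Extends (S2PV i)

/-- `S₂¹(PV)` is `∀Σᵇ₁(PV)`-conservative over `PV₁`: every `∀Σᵇ₁(PV)` theorem of `S₂¹(PV)`
is a theorem of `PV₁` (Buss 1986, Ch. 6, the main theorem on `S₂¹(PV)` and `PV₁`, obtained
from the witnessing theorem of Ch. 5; Krajíček 1995, §5.3 with the witnessing argument of
§7.2). [cite: Buss1986, Ch. 6  the main theorem on  S₂¹(PV] -/
def S2PV_one_isConservativeOver_PV1 : Prop :=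
  (S2PV 1).IsConservativeOver PV1 {φ | IsForallSigmabPV 1 φ}

/-- `T₂ⁱ(PV)` extends `S₂ⁱ(PV)` for `i ≥ 1`: `Σᵇᵢ(PV)-PIND` follows from `Σᵇᵢ(PV)-IND` over
`BASIC` (Buss 1986, Thm. 2.6 relativised to `L(PV)`, Ch. 6; Krajíček 1995, Lemma 5.2.5; same
orientation and hypothesis as G14 `S2_extends_T2` / `PNP.S2_extends_to_T2`).  The case `i = 0`
is *not* claimed: none of the sources states it, and with the present axiomatisation it would
yield `PV₁ ⊆ T₂⁰(PV)` (open `PIND` from `Σᵇ₀(PV)-IND`), which is not a printed theorem. [cite: Buss1986, Thm. 2.6 relativised to  L(PV] -/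
def S2PV_extends_to_T2PV : Prop :=
  ∀ {i : ℕ} (hi : 1 ≤ i),
    (S2PV i).Extends (T2PV i)

/-- `T₂ⁱ⁺¹(PV)` extends `S₂ⁱ⁺¹(PV)` for every `i` (successor form of `S2PV_extends_to_T2PV`;
Buss 1986, Thm. 2.6, Ch. 6; as G14 `S2_succ_extends_T2_succ`). [cite: Buss1986, Thm. 2.6  Ch. 6] -/
def S2PV_succ_extends_to_T2PV_succ : Prop :=
  ∀ (i : ℕ),
    (S2PV (i + 1)).Extends (T2PV (i + 1))

/- interim proof relied on results that are now named facts (D-0014); demoted to a fact by the M5 import, proof preserved: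
:=
  S2PV_extends_to_T2PV (Nat.succ_pos i)
-/

/-- `S₂ⁱ⁺¹(PV)` extends `T₂ⁱ(PV)`: `Σᵇᵢ(PV)-IND` follows from `Σᵇᵢ₊₁(PV)-PIND`
(Buss 1986, Cor. 2.16 relativised to `L(PV)`, Ch. 6; Krajíček 1995, Thm. 5.2.7; same
orientation as G14 `T2_extends_S2_succ`). [cite: Buss1986, Cor. 2.16 relativised to  L(PV] -/
def T2PV_extends_to_S2PV_succ : Prop :=
  ∀ (i : ℕ),
    (T2PV i).Extends (S2PV (i + 1))

/-- The **Krajíček–Pudlák–Takeuti hypothesis** at level `i`: `S₂ⁱ⁺¹(PV)` is (fully)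
conservative over `T₂ⁱ(PV)`, equivalently `T₂ⁱ(PV) = S₂ⁱ⁺¹(PV)` as sets of theorems
(Krajíček–Pudlák–Takeuti 1991, Main Theorem, stated there for `i ≥ 1`: this implies
`Σᵖᵢ₊₂ = Πᵖᵢ₊₂`, i.e. the polynomial hierarchy collapses; Krajíček 1995, §7.  The
`PH`-collapse consequence is stated with the `pnp` statements, not here).  Note that the
instance `i = 0` of this definition concerns `T2PV 0 = BASIC(PV) + PVdef + Σᵇ₀(PV)-IND`, *not*
`PV₁`; consumers wanting KPT's `PV₁`-based level-zero form should use `PV1` explicitly, and the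
printed theorem applies to `i ≥ 1`. [cite: PudlakTakeuti1991, Main Theorem  stated there for  i ≥ 1] -/
def KPTHypothesis (i : ℕ) : Prop :=
  (S2PV (i + 1)).IsConservativeOver (T2PV i) Set.univ

end Theories

end Literature.Analysis.FunctionSpaces
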